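import Mathlib
import Summits.NavierStokesRegularity.NavierStokesRegularity.Theorems.WakeRatchetTailRatchetInvariantBox
import Summits.NavierStokesRegularity.NavierStokesRegularity.Theorems.WakeRatchetTailRatchetWakeEnvelope
import HarnessLib

/-!
# `WakeRatchet.TailRatchet` (stmt-NavierStokesRegularity-21808): the usable end of the reduction chain —
# `DyadicScalarFronts` from invariant sets in a WEAK wake box (sharp envelope recovered by the matching)

Support file for the crux `TailRatchet` (route `WakeRatchet`; MODEL lattice ODEs of Tao 2016 §4 —
nothing here is a statement about the Navier–Stokes equations).  Seventh helper of this line of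
reductions; it repairs the one unrealistic hypothesis of `dyadicScalarFronts_of_invariantSets`
(`…InvariantBox.lean`): there the `K`-uniform box had to lie under the wake envelope taken at the UPPER end
`Tmax` of the flight-time window, `b n ≤ P((1+Tmax)/Λ)ⁿ` (`n<0`) — but a fixed point realised at a flight
time `T < Tmax` has wake `≍ ((1+T)/Λ)ⁿ`, which exceeds that envelope far down the wake.  What a floating
flight time CAN deliver is the weak envelope at the LOWER end, `W((1+Tmin)/Λ)ⁿ`.  Using
`wake_envelope_of_matching` (`…WakeEnvelope.lean`: the relative periodicity itself propagates the sharp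
ratio down the wake when the relative drift is summable) this file proves:

* `geomDrift_identity` — the scale bookkeeping `(|Λ^{-j-1}|(Wθ^{-j-1})² + |Λ^{-j}|(Wθ^{-j})(Wθ^{-j+1}))c^j
  = W²(Λ⁻¹θ⁻²+θ)(c/(Λθ²))^j`;
* `scalarFront_of_weakBoxWitness` — a full-lattice one-period witness on `[0,Tmax]` (matching at every
  shell with `c = (1+T)/Λ`, `T ∈ [Tmin,Tmax]`, `1+Tmax < (1+Tmin)²`) in a box under the weak wake envelope
  (`n ≤ 1`) and the leading-edge envelope (`n ≥ 0`) unrolls into a scalar front with `a(−(1+T)) = Z_0(0)`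
  (drift by `drift_le_of_box`, ratio `ρ = (1+T)/(1+Tmin)² < 1`, sharp envelope, time translation,
  `scalarFront_of_latticePeriod`);
* `dyadicScalarFronts_of_invariantSets_weak`, `not_tailRatchet_of_invariantSets_weak` — THE USABLE KILL
  CRITERION: for each small `ε₀`, a window with `1+Tmax < (1+Tmin)²`, a floor `lo>0`, a `K`-uniform box
  under `W((1+Tmin)/Λ)ⁿ` (`n≤1`) and `B((1+Tmax)Λ)^{-n}` (`n≥0`), and at arbitrarily high `K` a nonempty
  compact convex set of window states invariant under the one-period map of a box-respecting truncated
  flow with a continuous flight time ⟹ `DyadicScalarFronts` ⟹ `¬TailRatchet`.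

HONEST FRAMING: composition bookkeeping about a MODEL lattice; no registered stub is closed, no summit
statement is touched.
-/

noncomputable section

set_option linter.dupNamespace false

namespace Summit.NavierStokesRegularity.NavierStokesRegularity.Theorems

namespace WakeRatchetLatticePeriod

open Set Filter Topology MeasureTheory
open Literature.Analysis.FluidPDE Literature.Analysis.FluidPDE.TaoCascade
open WakeRatchetDyadicFront

/-- The scale bookkeeping behind the summable relative drift of a geometric wake box: at shell `-j`,
`(|Λ^{-j-1}| (Wθ^{-j-1})² + |Λ^{-j}| (Wθ^{-j})(Wθ^{-j+1})) · c^j = W² (Λ⁻¹θ⁻² + θ) · (c/(Λθ²))^j`.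
[elementary] -/
theorem geomDrift_identity {L θ W c : ℝ} (hL : 0 < L) (hθ : 0 < θ) (j : ℕ) :
    (|L ^ (-(j : ℤ) - 1)| * (W * θ ^ (-(j : ℤ) - 1)) ^ 2 +
        |L ^ (-(j : ℤ))| * ((W * θ ^ (-(j : ℤ))) * (W * θ ^ (-(j : ℤ) + 1)))) * c ^ j
      = W ^ 2 * (L⁻¹ * (θ ^ 2)⁻¹ + θ) * (c / (L * θ ^ 2)) ^ j := by
  have hLj : 0 < L ^ j := pow_pos hL j
  have hθj : 0 < θ ^ j := pow_pos hθ j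
  have e1 : L ^ (-(j : ℤ) - 1) = (L ^ j * L)⁻¹ := by
    rw [zpow_sub_one₀ hL.ne', zpow_neg, zpow_natCast]; field_simp
  have e2 : L ^ (-(j : ℤ)) = (L ^ j)⁻¹ := by rw [zpow_neg, zpow_natCast]
  have e3 : θ ^ (-(j : ℤ) - 1) = (θ ^ j * θ)⁻¹ := by
    rw [zpow_sub_one₀ hθ.ne', zpow_neg, zpow_natCast]; field_simp
  have e4 : θ ^ (-(j : ℤ)) = (θ ^ j)⁻¹ := by rw [zpow_neg, zpow_natCast]
  have e5 : θ ^ (-(j : ℤ) + 1) = (θ ^ j)⁻¹ * θ := by rw [zpow_add_one₀ hθ.ne', zpow_neg, zpow_natCast]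
  rw [e1, e2, e3, e4, e5, abs_of_pos (by positivity), abs_of_pos (by positivity), div_pow, mul_pow]
  field_simp
  ring

/-- **From a full-lattice one-period witness in a WEAK box to a scalar DSS front.**  Let `Z` solve the
dyadic lattice on `[0, Tmax]` with the matching `Z_n(T) = ((1+T)/Λ) Z_{n-1}(0)` at every shell, a flight time
`T ∈ [Tmin, Tmax]` in a window with `1 + Tmax < (1 + Tmin)²`, inside a box `b` dominated by the WEAK
geometric wake envelope `W ((1+Tmin)/Λ)ⁿ` for `n ≤ 1` (the direction a floating flight time delivers) and
the leading-edge envelope `B ((1+Tmax)Λ)^{-n}` for `n ≥ 0`.  Then the SHARP wake envelope at the realised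
ratio `(1+T)/Λ` holds (`wake_envelope_of_matching` + `drift_le_of_box`), and the time-translated witness
on `[-(1+T), -1]` unrolls (`scalarFront_of_latticePeriod`) into a scalar front, non-zero if `Z_0(0) ≠ 0`.
[cite: Tao2016AveragedNS, §1.2, §4 (4.8); elementary composition] -/
theorem scalarFront_of_weakBoxWitness {L Tmin Tmax T W B : ℝ} (b : ℤ → ℝ) {Z : ℤ → ℝ → ℝ}
    (hL : 0 < L) (hTmin : 0 < Tmin) (hT : T ∈ Icc Tmin Tmax) (hwin : 1 + Tmax < (1 + Tmin) ^ 2)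
    (hW : 0 ≤ W)
    (hD : ∀ n : ℤ, ∀ t ∈ Icc (0 : ℝ) Tmax, HasDerivWithinAt (Z n)
        (L ^ (n - 1) * Z (n - 1) t ^ 2 - L ^ n * Z n t * Z (n + 1) t) (Icc (0 : ℝ) Tmax) t)
    (hbox : ∀ n : ℤ, ∀ t ∈ Icc (0 : ℝ) Tmax, |Z n t| ≤ b n)
    (hmatch : ∀ n : ℤ, Z n T = (1 + T) / L * Z (n - 1) 0)
    (hbw : ∀ n : ℤ, n ≤ 1 → b n ≤ W * ((1 + Tmin) / L) ^ n)
    (hbl : ∀ n : ℤ, 0 ≤ n → b n ≤ B * (((1 + Tmax) * L) ^ n)⁻¹) :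
    ∃ a : ℝ → ℝ,
      (∀ t : ℝ, t < 0 → HasDerivAt a
        (L / (1 + T) ^ 2 * a (t / (1 + T)) ^ 2 - (1 + T) / L * a t * a ((1 + T) * t)) t) ∧
      IntegrableOn a (Iio 0) ∧
      (∃ t₀ : ℝ, t₀ < 0 ∧ ∃ P : ℝ, ∀ t : ℝ, t₀ ≤ t → t < 0 → |a t| ≤ P) ∧
      a (-(1 + T)) = Z 0 0 := by
  -- constants
  have hs1 : 1 < 1 + T := by linarith [hT.1]
  have hs0 : 0 < 1 + T := by linarith
  set c : ℝ := (1 + T) / L with hc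
  set θ : ℝ := (1 + Tmin) / L with hθ
  have hcpos : 0 < c := div_pos hs0 hL
  have hθpos : 0 < θ := div_pos (by linarith) hL
  set ρ : ℝ := c / (L * θ ^ 2) with hρ
  have hρ_eq : ρ = (1 + T) / (1 + Tmin) ^ 2 := by
    rw [hρ, hc, hθ]; field_simp
  have hρ0 : 0 ≤ ρ := by rw [hρ_eq]; positivity
  have hρ1 : ρ < 1 := by
    rw [hρ_eq, div_lt_one (by positivity)]; linarith [hT.2]
  have h0T : (0 : ℝ) ≤ Tmax := hTmin.le.trans (hT.1.trans hT.2)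
  have hb0 : ∀ n, 0 ≤ b n := fun n => (abs_nonneg _).trans (hbox n 0 ⟨le_rfl, h0T⟩)
  -- the summable relative drift down the wake
  set A : ℝ := W ^ 2 * (L⁻¹ * (θ ^ 2)⁻¹ + θ) * Tmax with hA
  have hdrift : ∀ j : ℕ, ∀ t ∈ Icc (0 : ℝ) Tmax,
      |Z (-(j : ℤ)) t - Z (-(j : ℤ)) 0| * c ^ j ≤ A * ρ ^ j := by
    intro j t ht
    have hd := drift_le_of_box b hD hbox (-(j : ℤ)) t ht
    have h1 : b (-(j : ℤ) - 1) ≤ W * θ ^ (-(j : ℤ) - 1) := hbw _ (by omega)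
    have h2 : b (-(j : ℤ)) ≤ W * θ ^ (-(j : ℤ)) := hbw _ (by omega)
    have h3 : b (-(j : ℤ) + 1) ≤ W * θ ^ (-(j : ℤ) + 1) := hbw _ (by omega)
    have hrate : |L ^ (-(j : ℤ) - 1)| * b (-(j : ℤ) - 1) ^ 2 + |L ^ (-(j : ℤ))| * (b (-(j : ℤ)) * b (-(j : ℤ) + 1))
        ≤ |L ^ (-(j : ℤ) - 1)| * (W * θ ^ (-(j : ℤ) - 1)) ^ 2 +
          |L ^ (-(j : ℤ))| * ((W * θ ^ (-(j : ℤ))) * (W * θ ^ (-(j : ℤ) + 1))) := by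
      have := hb0 (-(j : ℤ) - 1); have := hb0 (-(j : ℤ)); have := hb0 (-(j : ℤ) + 1)
      gcongr
    have hcj : 0 ≤ c ^ j := pow_nonneg hcpos.le j
    calc |Z (-(j : ℤ)) t - Z (-(j : ℤ)) 0| * c ^ j
        ≤ ((|L ^ (-(j : ℤ) - 1)| * b (-(j : ℤ) - 1) ^ 2 +
            |L ^ (-(j : ℤ))| * (b (-(j : ℤ)) * b (-(j : ℤ) + 1))) * t) * c ^ j :=
          mul_le_mul_of_nonneg_right hd hcj
      _ ≤ ((|L ^ (-(j : ℤ) - 1)| * (W * θ ^ (-(j : ℤ) - 1)) ^ 2 +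
            |L ^ (-(j : ℤ))| * ((W * θ ^ (-(j : ℤ))) * (W * θ ^ (-(j : ℤ) + 1)))) * Tmax) * c ^ j := by
          refine mul_le_mul_of_nonneg_right ?_ hcj
          exact mul_le_mul hrate ht.2 ht.1 (by positivity)
      _ = A * ρ ^ j := by
          rw [hA, hρ]
          have := geomDrift_identity (W := W) (c := c) hL hθpos j
          calc (|L ^ (-(j : ℤ) - 1)| * (W * θ ^ (-(j : ℤ) - 1)) ^ 2 +
                |L ^ (-(j : ℤ))| * ((W * θ ^ (-(j : ℤ))) * (W * θ ^ (-(j : ℤ) + 1)))) * Tmax * c ^ j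
              = ((|L ^ (-(j : ℤ) - 1)| * (W * θ ^ (-(j : ℤ) - 1)) ^ 2 +
                |L ^ (-(j : ℤ))| * ((W * θ ^ (-(j : ℤ))) * (W * θ ^ (-(j : ℤ) + 1)))) * c ^ j) * Tmax := by
                ring
            _ = W ^ 2 * (L⁻¹ * (θ ^ 2)⁻¹ + θ) * (c / (L * θ ^ 2)) ^ j * Tmax := by rw [this]
            _ = W ^ 2 * (L⁻¹ * (θ ^ 2)⁻¹ + θ) * Tmax * (c / (L * θ ^ 2)) ^ j := by ring
  have hmatchj : ∀ j : ℕ, Z (-(j : ℤ)) T = c * Z (-(j : ℤ) - 1) 0 := fun j => hmatch _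
  have hT0 : T ∈ Icc (0 : ℝ) Tmax := ⟨hTmin.le.trans hT.1, hT.2⟩
  have henv := wake_envelope_of_matching hcpos hT0 hρ0 hρ1 hmatchj hdrift
  set P₀ : ℝ := |Z 0 0| + A / (1 - ρ) + A with hP₀
  -- the data of `scalarFront_of_latticePeriod` for the translated witness
  have hmem : ∀ u ∈ Icc (-(1 + T)) (-1), u + (1 + T) ∈ Icc (0 : ℝ) Tmax := by
    intro u hu; exact ⟨by linarith [hu.1], by linarith [hu.2, hT.2]⟩
  have hD' : ∀ n : ℤ, ∀ u ∈ Icc (-(1 + T)) (-1), HasDerivWithinAt (fun u => Z n (u + (1 + T)))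
      (L ^ (n - 1) * Z (n - 1) (u + (1 + T)) ^ 2 - L ^ n * Z n (u + (1 + T)) * Z (n + 1) (u + (1 + T)))
      (Icc (-(1 + T)) (-1)) u := by
    intro n u hu
    have h2 : HasDerivAt (fun u : ℝ => u + (1 + T)) 1 u := (hasDerivAt_id u).add_const _
    have := (hD n (u + (1 + T)) (hmem u hu)).comp u h2.hasDerivWithinAt (fun u' hu' => hmem u' hu')
    simpa only [mul_one, Function.comp_def] using this
  have hper' : ∀ n : ℤ, Z n (-1 + (1 + T)) = (1 + T) / L * Z (n - 1) (-(1 + T) + (1 + T)) := by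
    intro n
    rw [show -1 + (1 + T) = T by ring, show -(1 + T) + (1 + T) = 0 by ring]
    exact hmatch n
  have hwake' : ∃ P' : ℝ, ∀ n : ℤ, n < 0 → ∀ u ∈ Icc (-(1 + T)) (-1),
      |Z n (u + (1 + T))| ≤ P' * ((1 + T) / L) ^ n := by
    refine ⟨P₀, fun n hn u hu => ?_⟩
    obtain ⟨j, rfl⟩ : ∃ j : ℕ, n = -(j : ℤ) := ⟨n.natAbs, by omega⟩
    have h := henv j (u + (1 + T)) (hmem u hu)
    rw [← hc, zpow_neg, zpow_natCast, ← div_eq_mul_inv, le_div_iff₀ (pow_pos hcpos j)]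
    exact h
  have hlead' : ∃ B' : ℝ, ∀ n : ℤ, 0 ≤ n → ∀ u ∈ Icc (-(1 + T)) (-1),
      |Z n (u + (1 + T))| ≤ B' * (((1 + T) * L) ^ n)⁻¹ := by
    have hB0 : 0 ≤ B := by
      have h := (hb0 0).trans (hbl 0 le_rfl)
      rwa [zpow_zero, inv_one, mul_one] at h
    refine ⟨B, fun n hn u hu => ?_⟩
    refine (hbox n _ (hmem u hu)).trans ((hbl n hn).trans (mul_le_mul_of_nonneg_left ?_ hB0))
    have hx : 0 < (1 + T) * L := mul_pos hs0 hL
    have hxy : (1 + T) * L ≤ (1 + Tmax) * L := mul_le_mul_of_nonneg_right (by linarith [hT.2]) hL.le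
    exact inv_anti₀ (zpow_pos hx _) (zpow_le_zpow_left₀ hn hx.le hxy)
  obtain ⟨a, hode, hint, hbdd, hdict⟩ := scalarFront_of_latticePeriod hL hs1 hD' hper' hwake' hlead'
  refine ⟨a, hode, hint, hbdd, ?_⟩
  have h := hdict 0 (-(1 + T)) ⟨le_rfl, by linarith⟩
  rw [zpow_zero, one_mul, zpow_zero, div_one, show -(1 + T) + (1 + T) = 0 by ring] at h
  exact h

/-- **The usable end of the chain: `DyadicScalarFronts` from invariant compact convex sets with a WEAK
wake box.**  As `dyadicScalarFronts_of_invariantSets`, but the `K`-uniform box `b` is only required to lie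
under the WEAK geometric wake envelope `W ((1+Tmin)/Λ)ⁿ` (`n ≤ 1`) — the one a floating flight time in
`[Tmin, Tmax]` can deliver — at the price of the window condition `1 + Tmax < (1 + Tmin)²`; the sharp
envelope at the realised flight time is recovered inside (`scalarFront_of_weakBoxWitness`).
[cite: Tao2016AveragedNS, §1.2, §4 (4.8); cell vocabulary (`DyadicScalarFronts`)] -/
theorem dyadicScalarFronts_of_invariantSets_weak
    (h : ∀ ε : ℝ, 0 < ε → ∃ ε₀ : ℝ, 0 < ε₀ ∧ ε₀ ≤ ε ∧
      ∃ (Tmin Tmax lo W B : ℝ) (b : ℤ → ℝ), 0 < Tmin ∧ Tmin ≤ Tmax ∧ 1 + Tmax < (1 + Tmin) ^ 2 ∧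
      0 < lo ∧ 0 ≤ W ∧
      (∀ n : ℤ, n ≤ 1 → b n ≤ W * ((1 + Tmin) / bigLam ε₀) ^ n) ∧
      (∀ n : ℤ, 0 ≤ n → b n ≤ B * (((1 + Tmax) * bigLam ε₀) ^ n)⁻¹) ∧
      ∀ K₀ : ℕ, ∃ K : ℕ, K₀ ≤ K ∧
        ∃ (C : Set (ℤ → ℝ)) (Tf : (ℤ → ℝ) → ℝ) (Φ : (ℤ → ℝ) → ℝ → (ℤ → ℝ)),
          Convex ℝ C ∧ IsCompact C ∧ C.Nonempty ∧
          (∀ x ∈ C, ∀ n : ℤ, (K : ℤ) < |n| → x n = 0) ∧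
          (∀ x ∈ C, lo ≤ x 0) ∧
          (∀ x ∈ C, (∀ n : ℤ, Φ x 0 n = x n) ∧
            (∀ n : ℤ, (K : ℤ) < |n| → ∀ t ∈ Icc (0 : ℝ) Tmax, Φ x t n = 0) ∧
            (∀ n : ℤ, |n| ≤ (K : ℤ) → ∀ t ∈ Icc (0 : ℝ) Tmax, HasDerivWithinAt (fun s => Φ x s n)
              (bigLam ε₀ ^ (n - 1) * Φ x t (n - 1) ^ 2 - bigLam ε₀ ^ n * Φ x t n * Φ x t (n + 1))
              (Icc (0 : ℝ) Tmax) t)) ∧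
          (∀ n : ℤ, ContinuousOn (fun p : (ℤ → ℝ) × ℝ => Φ p.1 p.2 n) (C ×ˢ Icc (0 : ℝ) Tmax)) ∧
          (∀ x ∈ C, ∀ n : ℤ, ∀ t ∈ Icc (0 : ℝ) Tmax, |Φ x t n| ≤ b n) ∧
          ContinuousOn Tf C ∧ (∀ x ∈ C, Tf x ∈ Icc Tmin Tmax) ∧
          (∀ x ∈ C, (fun n : ℤ => if -(K : ℤ) ≤ n ∧ n ≤ (K : ℤ) - 1 then
            ((1 + Tf x) / bigLam ε₀)⁻¹ * Φ x (Tf x) (n + 1) else 0) ∈ C)) :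
    DyadicScalarFronts := by
  intro ε hε
  obtain ⟨ε₀, hε₀, hle, Tmin, Tmax, lo, W, B, b, hTmin, hTT, hwin, hlo, hW, hbw, hbl, H⟩ := h ε hε
  have hΛ : 0 < bigLam ε₀ := bigLam_pos (by linarith)
  -- relative periodic points of the truncations (Schauder), then the full-lattice witness (limit)
  have H' : ∀ K₀ : ℕ, ∃ K : ℕ, K₀ ≤ K ∧ ∃ (T : ℝ) (Z : ℤ → ℝ → ℝ), T ∈ Icc Tmin Tmax ∧
      (∀ n : ℤ, |n| ≤ (K : ℤ) → ∀ t ∈ Icc (0 : ℝ) Tmax, HasDerivWithinAt (Z n)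
        (bigLam ε₀ ^ (n - 1) * Z (n - 1) t ^ 2 - bigLam ε₀ ^ n * Z n t * Z (n + 1) t)
        (Icc (0 : ℝ) Tmax) t) ∧
      (∀ n : ℤ, (K : ℤ) < |n| → ∀ t ∈ Icc (0 : ℝ) Tmax, Z n t = 0) ∧
      (∀ n : ℤ, ∀ t ∈ Icc (0 : ℝ) Tmax, |Z n t| ≤ b n) ∧
      (∀ n : ℤ, |n| < (K : ℤ) → Z n T = (1 + T) / bigLam ε₀ * Z (n - 1) 0) ∧
      lo ≤ Z 0 0 := by
    intro K₀
    obtain ⟨K, hK, C, Tf, Φ, hCconv, hCcomp, hCne, hCK, hClo, hΦ, hΦc, hb, hTc, hTI, hinv⟩ := H K₀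
    obtain ⟨T, Z, hT, hD, hz, hbZ, hmatch, hfloor⟩ :=
      truncatedPeriod_of_invariant b C Tf Φ hΛ hTmin hCconv hCcomp hCne hCK hClo hΦ hΦc hb hTc hTI hinv
    exact ⟨K, hK, T, Z, hT, hD, hz, hbZ, hmatch, hfloor⟩
  obtain ⟨T, Z, hT, hD, hbox, hmatch, hZ0⟩ := latticePeriod_of_truncations b hTmin hTT H'
  -- sharp wake envelope and unrolling
  obtain ⟨a, hode, hint, hbdd, ha0⟩ :=
    scalarFront_of_weakBoxWitness b hΛ hTmin hT hwin hW hD hbox hmatch hbw hbl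
  refine ⟨ε₀, hε₀, hle, 1 + T, by linarith [hT.1], a, hode, hint, hbdd, -(1 + T), by linarith [hT.1], ?_⟩
  rw [ha0]
  exact ne_of_gt (lt_of_lt_of_le hlo hZ0)

/-- **Kill criterion for `TailRatchet`, usable form.**  Invariant compact convex sets of the truncated
one-period maps in boxes under the WEAK wake envelope (window `1 + Tmax < (1+Tmin)²`), at arbitrarily small
scale ratios, refute `WakeRatchet.TailRatchet` (stmt-NavierStokesRegularity-21808).
[cite: Tao2016AveragedNS, §1.2, §4; cell vocabulary] -/
theorem not_tailRatchet_of_invariantSets_weak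
    (h : ∀ ε : ℝ, 0 < ε → ∃ ε₀ : ℝ, 0 < ε₀ ∧ ε₀ ≤ ε ∧
      ∃ (Tmin Tmax lo W B : ℝ) (b : ℤ → ℝ), 0 < Tmin ∧ Tmin ≤ Tmax ∧ 1 + Tmax < (1 + Tmin) ^ 2 ∧
      0 < lo ∧ 0 ≤ W ∧
      (∀ n : ℤ, n ≤ 1 → b n ≤ W * ((1 + Tmin) / bigLam ε₀) ^ n) ∧
      (∀ n : ℤ, 0 ≤ n → b n ≤ B * (((1 + Tmax) * bigLam ε₀) ^ n)⁻¹) ∧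
      ∀ K₀ : ℕ, ∃ K : ℕ, K₀ ≤ K ∧
        ∃ (C : Set (ℤ → ℝ)) (Tf : (ℤ → ℝ) → ℝ) (Φ : (ℤ → ℝ) → ℝ → (ℤ → ℝ)),
          Convex ℝ C ∧ IsCompact C ∧ C.Nonempty ∧
          (∀ x ∈ C, ∀ n : ℤ, (K : ℤ) < |n| → x n = 0) ∧
          (∀ x ∈ C, lo ≤ x 0) ∧
          (∀ x ∈ C, (∀ n : ℤ, Φ x 0 n = x n) ∧
            (∀ n : ℤ, (K : ℤ) < |n| → ∀ t ∈ Icc (0 : ℝ) Tmax, Φ x t n = 0) ∧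
            (∀ n : ℤ, |n| ≤ (K : ℤ) → ∀ t ∈ Icc (0 : ℝ) Tmax, HasDerivWithinAt (fun s => Φ x s n)
              (bigLam ε₀ ^ (n - 1) * Φ x t (n - 1) ^ 2 - bigLam ε₀ ^ n * Φ x t n * Φ x t (n + 1))
              (Icc (0 : ℝ) Tmax) t)) ∧
          (∀ n : ℤ, ContinuousOn (fun p : (ℤ → ℝ) × ℝ => Φ p.1 p.2 n) (C ×ˢ Icc (0 : ℝ) Tmax)) ∧
          (∀ x ∈ C, ∀ n : ℤ, ∀ t ∈ Icc (0 : ℝ) Tmax, |Φ x t n| ≤ b n) ∧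
          ContinuousOn Tf C ∧ (∀ x ∈ C, Tf x ∈ Icc Tmin Tmax) ∧
          (∀ x ∈ C, (fun n : ℤ => if -(K : ℤ) ≤ n ∧ n ≤ (K : ℤ) - 1 then
            ((1 + Tf x) / bigLam ε₀)⁻¹ * Φ x (Tf x) (n + 1) else 0) ∈ C)) :
    ¬ Summit.NavierStokesRegularity.NavierStokesRegularity.Theses.WakeRatchet.TailRatchet :=
  TailRatchet_false_of_DyadicScalarFronts (dyadicScalarFronts_of_invariantSets_weak h)

end WakeRatchetLatticePeriod

end Summit.NavierStokesRegularity.NavierStokesRegularity.Theorems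

end
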